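import Mathlib
import Literature.MathematicalPhysics.KineticTheory.FouriersLaw
import Literature.MathematicalPhysics.KineticTheory.LangevinChainGibbs

/-!
# Sketch — crux-ideate, crux `JunctionLocality.SuperadditiveResistance` (stmt-AtomisticToContinuum-11748)

First lemmas of the two idea cards, stated over existing declarations (not proved; they must only
elaborate).  `generator` at `γ = 0` is the pure Liouvillian `A_N` of the `N`-site chain (the bath
terms carry the factor `P.γ`).
-/

noncomputable section

open MeasureTheory

namespace Summit.AtomisticToContinuum.FouriersLaw.Cruxes.SuperadditiveResistance.Sketch

open Literature.MathematicalPhysics.KineticTheory.HeatConduction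

/-- Restriction of a phase point of the `(N+M)`-site chain to its LEFT ARM (sites `0 … N-1`). -/
def leftArm (N M : ℕ) (x : PhaseSpace (N + M)) : PhaseSpace N :=
  (fun i => x.1 (Fin.castAdd M i), fun i => x.2 (Fin.castAdd M i))

/-- `g` does not depend on the momentum coordinate `p_i`. -/
def IndepOfMomentum {N : ℕ} (i : Fin N) (g : PhaseSpace N → ℝ) : Prop :=
  ∀ x : PhaseSpace N, ∀ t : ℝ, g (x.1, Function.update x.2 i t) = g x

/-- The Liouvillian of the `N`-site pinned chain: the generator with the baths switched off
(`γ = 0`; the temperatures are then immaterial). -/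
def liouvillian (ω₂ lam β : ℝ) (N : ℕ) (g : PhaseSpace N → ℝ) (x : PhaseSpace N) : ℝ :=
  (pinnedChain ω₂ lam β 0).generator N 0 0 g x

/-- ADMISSIBILITY of a (finite) measure `ρ` on the phase space of the `N`-site chain whose baths
sit on sites `0` and `N-1`: `ρ` is invariant under the Hamiltonian flow UP TO BATH DIRECTIONS,
i.e. `∫ A_N g dρ = 0` for every smooth `g` that does not depend on the two bath momenta.  This is
exactly the finiteness domain of the Donsker–Varadhan functional of the bathed chain (the
"bulk-invariant admissible class" of the meta-lemma). -/
def BulkInvariantUpToBaths (ω₂ lam β : ℝ) (N : ℕ) (b₀ b₁ : Fin N)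
    (ρ : Measure (PhaseSpace N)) : Prop :=
  ∀ g : PhaseSpace N → ℝ, ContDiff ℝ (⊤ : ℕ∞) g → IndepOfMomentum b₀ g → IndepOfMomentum b₁ g →
    Integrable (liouvillian ω₂ lam β N g) ρ → ∫ x, liouvillian ω₂ lam β N g x ∂ρ = 0

/-- **First lemma of card `cut-dont-glue-dv-restriction` (MARGINAL ADMISSIBILITY).**
If a finite measure `ρ` on the phase space of the `(N+M)`-chain is bulk-invariant up to the bath
directions at sites `0` and `N+M-1`, then its left-arm marginal is bulk-invariant up to the bath
directions at sites `0` and `N-1` of the `N`-chain: the right arm acts on the left arm only through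
the junction force `V'(q_N - q_{N-1}) ∂_{p_{N-1}}`, a direction a Langevin bath at `N-1` absorbs.
(`A_{N+M}(g ∘ leftArm) = (A_N g) ∘ leftArm + V'(q_N - q_{N-1}) · (∂_{p_{N-1}} g) ∘ leftArm`.) -/
theorem marginal_admissible (ω₂ lam β : ℝ) (N M : ℕ) (hN : 2 ≤ N) (hM : 1 ≤ M)
    (ρ : Measure (PhaseSpace (N + M))) [IsFiniteMeasure ρ]
    (hρ : BulkInvariantUpToBaths ω₂ lam β (N + M) ⟨0, by omega⟩ ⟨N + M - 1, by omega⟩ ρ) :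
    BulkInvariantUpToBaths ω₂ lam β N ⟨0, by omega⟩ ⟨N - 1, by omega⟩ (ρ.map (leftArm N M)) := by
  sorry

/-- **First lemma of card `in-situ-stein-bath-factor` (CARRÉ DU CHAMP AT EQUILIBRIUM = cheap Stein
factors in bath directions).**  For the pinned chain between two baths at the SAME temperature `T`,
the Gibbs measure `μ_T` is stationary and the Dirichlet form of the generator charges only the two
bath momenta: `∫ f (-L f) dμ_T = γ T ∑_{b ∈ {0, N-1}} ∫ (∂_{p_b} f)² dμ_T`.  Consequently a solution
of the Poisson equation `-L f = g` has `γ T ‖∂_{p_b} f‖² ≤ ∫ f g dμ_T` — for `g` a bond current this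
is `T² G_N = O(1/N)`. -/
theorem dirichletForm_generator_gibbs (ω₂ lam β γ T : ℝ) (hω : 0 < ω₂) (hl : 0 ≤ lam) (hβ : 0 ≤ β)
    (hγ : 0 < γ) (hT : 0 < T) (N : ℕ) (f : PhaseSpace N → ℝ) (hf : ContDiff ℝ (⊤ : ℕ∞) f)
    (hfc : HasCompactSupport f) :
    ∫ x, f x * (-(pinnedChain ω₂ lam β γ).generator N T T f x)
        ∂(pinnedChain ω₂ lam β γ).gibbsMeasure N T =
      γ * T * ∑ i : Fin N, ((if i.val = 0 then (1 : ℝ) else 0) + (if i.val = N - 1 then 1 else 0)) *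
        ∫ x, (partialP i f x) ^ 2 ∂(pinnedChain ω₂ lam β γ).gibbsMeasure N T := by
  sorry

/-- **In-situ telescoping (card `in-situ-stein-bath-factor`, the exact bookkeeping step; pure
algebra).**  If the end-to-end temperature drop splits as left-arm drop + junction-bond drop +
right-arm drop and the current `J ≠ 0` is common, the end-to-end resistance is the sum of the three
in-situ resistances. -/
theorem inSitu_telescoping (TL Ta Tb TR J : ℝ) (hJ : J ≠ 0) :
    (TL - TR) / J = (TL - Ta) / J + (Ta - Tb) / J + (Tb - TR) / J := by
  field_simp
  ring

end Summit.AtomisticToContinuum.FouriersLaw.Cruxes.SuperadditiveResistance.Sketch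

end
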